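import Summits.BirchSwinnertonDyer.BirchSwinnertonDyer.Theorems.PrintX11aMuCosetCertificate
import HarnessLib

/-!
# Route `PrintX11a` (cell `bsd-print-x11a`, seat p3): the Teichmüller-coset `μ`-certificate — THE DOORS
# (sequel of `PrintX11aMuCosetCertificate.lean`; `--supports stmt-BirchSwinnertonDyer-20614 --as helper`)

§5 `X11a.muAnZeroAt_of_cosetTable`: for `W/ℚ` globally minimal, `p` an ODD multiplicative prime with
`E[p]` irreducible, the displayed special value `L(E,1)/Ω_E = t` (`‖t‖_p ≤ 1`), a level `n`, an exponent
`s₀` and a table `xs` of `p − 1` rationals on the Teichmüller coset `{b ∈ ℤ/p^{n+1} : b^{p−1} =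
(1+p)^{(p−1)s₀}}` with `ϖ·[b/p^{n+1}]⁺_f = xs b` (DISPLAYED — ty3's `mu` column, the plus modular
symbols normalised by `x(0) = L(E,1)/Ω_E`) and `‖∑_b xs b‖_p = 1` (KERNEL): `X11a.MuAnZeroAt W p` —
modulo Mazur 1978 Cor. 4.1 (`mazur_not_dvd_maninConstant_of_odd`, `‖ϖ‖_p = 1`). The mathematics is in
the prequel (§1 one unit coset mass ⇒ one unit Riemann sum below degree `pⁿ`; §2 the coset as a
decidable finset; §3 the tree's congruence certificate modulo `p` for THE Mazur–Tate–Teitelbaum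
function; §4 integrality of the table in analytic rank zero).
§6 composes with ty2's part 6 (`X11a/PrintDischargeMuAn.lean`): `ClassX11a.missingUpperBoundAt_of_cosetTable`
(crux `X11aNonSurjEulerHalf` currency `Typed.MissingUpperBoundAt W p` at a non-surjective X11a pair from
the ten displayed facts + Greenberg–Stevens + Mazur + the image bit + `t` + the table; `_of_nonsplit`
without Greenberg–Stevens) and `ClassX11a.bsdp_of_cosetTable_of_unit[_of_nonsplit]` (`BSDp W p` on a
unit cell). So a μ-witness RECORD (ty3 `RecordsLeafNonSurjMuPart1–2`, `RecordsThreeNonSurjMu`: 37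
hard-locus pairs) is consumed through its `p − 1` displayed symbol VALUES and kernel arithmetic — no
assumed `Record.MuClaim`.

HONEST FRAMING: per pair (E1 currency), never the leaf; U5/U3 (`∀` non-surjective X11a pairs) stay
OPEN (Greenberg μ on the non-surjective locus, barrier B3); theorems only, no definition, no new named
fact, no `sorry`; beyond-print theorem: no. Nothing is booked by this file.

References: [MazurTateTeitelbaum1986Invent] §I.10, §I.12–I.13; [Mazur1978] Cor. 4.1;
[Kato2004Asterisque] Thm. 12.4, §17.13; [Wuthrich2014] Cor. 18; [SteinWuthrich2013] Thm. 6.1, §3;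
[Miller2011LMS] Def. 1.1; cell files HOME/TY2-DISCHARGE-INTERFACE.md §J, HOME/TY3-CERTIFICATE-RECORDS.md §7.
-/

set_option autoImplicit false

noncomputable section

open scoped Classical MatrixGroups ModularForm

open CongruenceSubgroup WeierstrassCurve Literature.NumberTheory.EllipticCurves
  Literature.NumberTheory.EllipticCurves.ModularForms
  Literature.NumberTheory.EllipticCurves.Rank1Residual
  Literature.NumberTheory.EllipticCurves.Rank1Residual.Typed
  Literature.NumberTheory.EllipticCurves.Wuthrich2014
  Literature.NumberTheory.EllipticCurves.SteinWuthrich2013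
  Literature.NumberTheory.EllipticCurves.Greenberg1999
  Literature.NumberTheory.EllipticCurves.Kato2004

namespace Summit.BirchSwinnertonDyer.Rank1Residual.X11a

namespace MuCoset

/-! ### §4 Integrality of the table `ϖ·[·]⁺_f` in analytic rank zero -/

section Integrality

variable (W : WeierstrassCurve ℚ) [W.IsElliptic] (p : ℕ) [Fact p.Prime]

omit [W.IsElliptic] in
/-- **All-levels integrality of the Néron-normalised symbol table at an odd multiplicative prime**:
`‖ϖ‖_p ≤ 1` and `‖ϖ·[0]⁺_f‖_p ≤ 1` give `‖ϖ·[a/p^m]⁺_f‖_p ≤ 1` for ALL `m, a`, by the tree's uniform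
bound `‖[a/p^m]⁺_f‖_p ≤ max(1, ‖[0]⁺_f‖_p)` (Manin's cusp class of `1/p` + the `U_p`-relation at `0`,
`IsNewformOf.norm_ratPlusSymbol_val_div_le_max_of_multiplicative`). [cite: MazurTateTeitelbaum1986Invent, §I.4 (4.2), §I.8 and §I.10]
[cite: CremonaAlgorithms1997, §2.2 Lemma 2.2.3] -/
theorem norm_periodRatio_mul_ratPlusSymbol_le_one (hp2 : p ≠ 2) {N : ℕ} [NeZero N]
    {f : CuspForm (Gamma0 N) 2} (hf : IsNewformOf W f)
    (hmult : W.HasMultiplicativeReductionAtPrime p) {ϖ : ℚ} (hϖ1 : ‖((ϖ : ℚ) : ℚ_[p])‖ ≤ 1)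
    (h0 : ‖((ϖ * ratPlusSymbol f 0 : ℚ) : ℚ_[p])‖ ≤ 1) (m : ℕ) (a : ZMod (p ^ m)) :
    ‖((ϖ * ratPlusSymbol f ((a.val : ℚ) / (p : ℚ) ^ m) : ℚ) : ℚ_[p])‖ ≤ 1 := by
  have hb := hf.norm_ratPlusSymbol_val_div_le_max_of_multiplicative hp2 hmult m a
  rw [Rat.cast_mul, norm_mul]
  rcases le_max_iff.mp hb with h | h
  · calc ‖((ϖ : ℚ) : ℚ_[p])‖ * ‖((ratPlusSymbol f ((a.val : ℚ) / (p : ℚ) ^ m) : ℚ) : ℚ_[p])‖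
        ≤ 1 * 1 := mul_le_mul hϖ1 h (norm_nonneg _) zero_le_one
      _ = 1 := one_mul 1
  · calc ‖((ϖ : ℚ) : ℚ_[p])‖ * ‖((ratPlusSymbol f ((a.val : ℚ) / (p : ℚ) ^ m) : ℚ) : ℚ_[p])‖
        ≤ ‖((ϖ : ℚ) : ℚ_[p])‖ * ‖((ratPlusSymbol f 0 : ℚ) : ℚ_[p])‖ :=
          mul_le_mul_of_nonneg_left h (norm_nonneg _)
      _ = ‖((ϖ * ratPlusSymbol f 0 : ℚ) : ℚ_[p])‖ := by rw [Rat.cast_mul, norm_mul]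
      _ ≤ 1 := h0

/-- **`ϖ·[0]⁺_f = L(E,1)/Ω_E`**: the Néron-normalised constant symbol is the displayed rational `t`
(`L(E,1) = [0]⁺_f·Ω⁺_f`, `ϖ·Ω_E = Ω⁺_f`, `Ω_E > 0`). [cite: MazurTateTeitelbaum1986Invent, §I.8 (8.6)] -/
theorem periodRatio_mul_ratPlusSymbol_zero_eq {N : ℕ} [NeZero N] {f : CuspForm (Gamma0 N) 2}
    (hf : IsNewformOf W f) {ϖ : ℚ} (hϖ : (ϖ : ℝ) * W.realPeriodRat = plusPeriod f)
    {t : ℚ} (ht : W.entireLFunction 1 / (W.realPeriodRat : ℂ) = (t : ℂ)) :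
    ϖ * ratPlusSymbol f 0 = t := by
  have hΩpos : 0 < W.realPeriodRat := W.realPeriodRat_pos_holds
  have hΩC : (W.realPeriodRat : ℂ) ≠ 0 := Complex.ofReal_ne_zero.mpr hΩpos.ne'
  have hLval : W.entireLFunction 1 = ((((ratPlusSymbol f 0 : ℚ) : ℝ) * plusPeriod f : ℝ) : ℂ) :=
    hf.entireLFunction_one_eq
  have hq : W.entireLFunction 1 / (W.realPeriodRat : ℂ) = (((ϖ * ratPlusSymbol f 0 : ℚ)) : ℂ) := by
    rw [hLval, ← hϖ, div_eq_iff hΩC]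
    push_cast
    ring
  have h := ht.symm.trans hq
  exact_mod_cast h.symm

end Integrality

end MuCoset

/-! ### §5 The door: a displayed Teichmüller-coset table ⇒ `X11a.MuAnZeroAt W p` (odd multiplicative `p`, rank 0) -/

section Door

variable {W : WeierstrassCurve ℚ} [W.IsElliptic] [W.IsGloballyMinimal] {p : ℕ} [Fact p.Prime]

/-- **THE TEICHMÜLLER-COSET `μ`-CERTIFICATE (kernel form of ty3's `mu` column).** For `W/ℚ` globally
minimal with multiplicative reduction at an ODD prime `p` and `E[p]` irreducible, the displayed special
value `L(E,1)/Ω_E = t` with `‖t‖_p ≤ 1`, a level `n`, an exponent `s₀`, and a finite table `xs` on the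
coset `{b ∈ ℤ/p^{n+1} : b^{p−1} = (1+p)^{(p−1)s₀}}` (the Teichmüller coset of `u = (1+p)^{s₀}`) such
that — for every newform `f` of `W` and its period ratio `ϖ` (`ϖ·Ω_E = Ω⁺_f`) — `ϖ·[b/p^{n+1}]⁺_f = xs b`
on the coset (DISPLAYED: `p − 1` exact rationals, the plus modular symbols normalised by
`x(0) = L(E,1)/Ω_E`) and `‖∑_b xs b‖_p = 1` (KERNEL arithmetic): `X11a.MuAnZeroAt W p`, i.e. for THE
Mazur–Tate–Teitelbaum function of the reduction sign's kind SOME coefficient of `ϖ·L_p` is a unit.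
Modulo ONE named fact: Mazur 1978 Cor. 4.1 (`mazur_not_dvd_maninConstant_of_odd`, giving `‖ϖ‖_p = 1`).
Per pair (E1 currency); nothing booked; the class-wide μ statement stays open.
[cite: MazurTateTeitelbaum1986Invent, §I.10 (μ_E(a + pⁿℤ_p) = a_p^{−n}[a/pⁿ]⁺), §I.12–I.13]
[cite: Mazur1978, Cor. 4.1] [cite: SteinWuthrich2013, §3 and §4.2] [cite: GreenbergVatsal2000, p. 2–4 and §3 Rem. 3.4] -/
theorem muAnZeroAt_of_cosetTable (hMz : mazur_not_dvd_maninConstant_of_odd) (hp2 : p ≠ 2)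
    (hmult : W.HasMultiplicativeReductionAtPrime p) (hirr : W.HasIrreducibleModPGaloisRep p)
    (t : ℚ) (ht : W.entireLFunction 1 / (W.realPeriodRat : ℂ) = (t : ℂ))
    (htint : ‖((t : ℚ) : ℚ_[p])‖ ≤ 1) (n : ℕ) (s₀ : ZMod (p ^ n)) (S : Finset (ZMod (p ^ (n + 1))))
    (hS : ∀ b : ZMod (p ^ (n + 1)),
      b ∈ S ↔ b ^ (p - 1) = ((1 + p : ℕ) : ZMod (p ^ (n + 1))) ^ ((p - 1) * s₀.val))
    (xs : ZMod (p ^ (n + 1)) → ℚ)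
    (hxs : ∀ {N : ℕ} [NeZero N] (f : CuspForm (Gamma0 N) 2), IsNewformOf W f →
      ∀ (ϖ : ℚ), (ϖ : ℝ) * W.realPeriodRat = plusPeriod f →
        ∀ b ∈ S, ϖ * ratPlusSymbol f ((b.val : ℚ) / (p : ℚ) ^ (n + 1)) = xs b)
    (hunit : ‖((∑ b ∈ S, xs b : ℚ) : ℚ_[p])‖ = 1) :
    X11a.MuAnZeroAt W p := by
  have he : cyclotomicExponent p = 1 := if_neg hp2
  have hγ : cyclotomicGenerator p = 1 + p := by rw [cyclotomicGenerator, he, pow_one]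
  have hτ : torsionOrder p = p - 1 := by rw [torsionOrder_eq, if_neg hp2]
  intro N _ f hf ϖ hϖ
  -- integrality of the table at all levels
  have hϖ1 : ‖((ϖ : ℚ) : ℚ_[p])‖ ≤ 1 :=
    (X11b.ClassClosure.norm_ratCast_periodRatio_eq_one_of_mazur W p hMz hp2 hmult hirr hf hϖ).le
  have h0 : ‖((ϖ * ratPlusSymbol f 0 : ℚ) : ℚ_[p])‖ ≤ 1 := by
    rw [MuCoset.periodRatio_mul_ratPlusSymbol_zero_eq W hf hϖ ht]; exact htint
  have hint := MuCoset.norm_periodRatio_mul_ratPlusSymbol_le_one W p hp2 hf hmult hϖ1 h0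
  -- the coset sum in the general currency
  have hkey : (∑ᶠ ξ : rootsOfUnity (torsionOrder p) ℤ_[p],
      ((ϖ * ratPlusSymbol f
        (((PadicInt.toZModPow (n + cyclotomicExponent p) ((ξ : ℤ_[p]ˣ) : ℤ_[p]) *
            (cyclotomicGenerator p : ZMod (p ^ (n + cyclotomicExponent p))) ^ s₀.val).val : ℚ) /
          (p : ℚ) ^ (n + cyclotomicExponent p)) : ℚ) : ℚ_[p])) =
      ((∑ b ∈ S, xs b : ℚ) : ℚ_[p]) := by
    have hfS : Finset.univ.filter (fun b : ZMod (p ^ (n + 1)) ↦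
        b ^ (p - 1) = ((1 + p : ℕ) : ZMod (p ^ (n + 1))) ^ ((p - 1) * s₀.val)) = S := by
      ext b
      simp only [Finset.mem_filter, Finset.mem_univ, true_and, hS]
    rw [MuCoset.finsum_coset_eq_sum_filter p hp2 n s₀ (fun b ↦ ((ϖ * ratPlusSymbol f
      ((b.val : ℚ) / (p : ℚ) ^ (n + cyclotomicExponent p)) : ℚ) : ℚ_[p]))]
    rw [he, hτ, hγ, hfS, Rat.cast_sum]
    exact Finset.sum_congr rfl fun b hb ↦ by rw [hxs f hf ϖ hϖ b hb]
  have hunit' : ‖∑ᶠ ξ : rootsOfUnity (torsionOrder p) ℤ_[p],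
      ((ϖ * ratPlusSymbol f
        (((PadicInt.toZModPow (n + cyclotomicExponent p) ((ξ : ℤ_[p]ˣ) : ℤ_[p]) *
            (cyclotomicGenerator p : ZMod (p ^ (n + cyclotomicExponent p))) ^ s₀.val).val : ℚ) /
          (p : ℚ) ^ (n + cyclotomicExponent p)) : ℚ) : ℚ_[p])‖ = 1 := by
    rw [hkey]; exact hunit
  refine ⟨fun hns L hL ↦ ?_, fun hs L hL ↦ ?_⟩
  · obtain ⟨k, -, hk⟩ := MuCoset.exists_norm_coeff_eq_one_of_cosetSum_nonsplit W p hf hmult hns ϖ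
      hint s₀ hunit' hL
    exact ⟨k, hk⟩
  · obtain ⟨k, -, hk⟩ := MuCoset.exists_norm_coeff_eq_one_of_cosetSum_split W p hf hs ϖ hint s₀
      hunit' hL
    exact ⟨k, hk⟩

end Door

/-! ### §6 Crux-U currency per pair: the coset table through ty2's part-6 doors -/

section Currency

variable {W : WeierstrassCurve ℚ} [W.IsElliptic] [W.IsGloballyMinimal] {p : ℕ} [Fact p.Prime]

/-- **PER-PAIR DOOR (crux `X11aNonSurjEulerHalf` currency): a Teichmüller-coset table closes the
Euler half at a non-surjective X11a pair** — `Typed.MissingUpperBoundAt W p` from: the ten named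
facts of ty2's `ClassX11a.missingUpperBoundAt_of_muAnZeroAt_of_not_surj` (SW13 Thm 6.1 ×2, GZK,
modularity, Kato 12.4 / §17.13 ×3, Greenberg 1.5, Wuthrich Cor 18), Greenberg–Stevens at the pair
(`hGS`; vacuous when `p` is non-split, see `…_of_nonsplit`), Mazur 1978 Cor. 4.1 (`hMz`), the class
`hX`, the image bit `hnsj` (DISPLAYED), the special value `t = L(E,1)/Ω_E` (DISPLAYED, `‖t‖_p ≤ 1`
kernel) and the table `xs` on the coset (DISPLAYED, `p − 1` rationals; unit sum KERNEL). No μ-claim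
is assumed. [cite: Kato2004Asterisque, Thm. 12.4 (p. 221), §17.13 (pp. 279–280)] [cite: Wuthrich2014, Cor. 18 (p. 398)]
[cite: SteinWuthrich2013, Thm. 6.1 (p. 20)] [cite: MazurTateTeitelbaum1986Invent, §I.10, §I.12–I.13]
[cite: Mazur1978, Cor. 4.1] [cite: Miller2011LMS, Def. 1.1] -/
theorem _root_.Summit.BirchSwinnertonDyer.Rank1Residual.ClassX11a.missingUpperBoundAt_of_cosetTable
    (hJs : thm61_splitMultiplicative) (hJn : thm61_nonsplitMultiplicative)
    (hGZK : rank_eq_analyticRank_of_analyticRank_le_one) (hpar : nonempty_modularParametrizationData)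
    (h12 : Kato2004.thm12_4)
    (hns : Kato2004.exists_multDivisibilityInputs_nonsplit)
    (hsp : Kato2004.exists_multDivisibilityInputs_split)
    (h15 : thm15_isTorsion_multiplicative_rat)
    (h18 : Wuthrich2014.corollary18_padicLFunction_mem_iwasawaAlgebra_multiplicative)
    (hfine : Kato2004.exists_multDivisibilityInputs_fine)
    (hGS : greenberg_stevens (W := W) (p := p)) (hMz : mazur_not_dvd_maninConstant_of_odd)
    (hX : ClassX11a W p) (hnsj : ¬ Surj W p)
    (t : ℚ) (ht : W.entireLFunction 1 / (W.realPeriodRat : ℂ) = (t : ℂ))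
    (htint : ‖((t : ℚ) : ℚ_[p])‖ ≤ 1) (n : ℕ) (s₀ : ZMod (p ^ n)) (S : Finset (ZMod (p ^ (n + 1))))
    (hS : ∀ b : ZMod (p ^ (n + 1)),
      b ∈ S ↔ b ^ (p - 1) = ((1 + p : ℕ) : ZMod (p ^ (n + 1))) ^ ((p - 1) * s₀.val))
    (xs : ZMod (p ^ (n + 1)) → ℚ)
    (hxs : ∀ {N : ℕ} [NeZero N] (f : CuspForm (Gamma0 N) 2), IsNewformOf W f →
      ∀ (ϖ : ℚ), (ϖ : ℝ) * W.realPeriodRat = plusPeriod f →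
        ∀ b ∈ S, ϖ * ratPlusSymbol f ((b.val : ℚ) / (p : ℚ) ^ (n + 1)) = xs b)
    (hunit : ‖((∑ b ∈ S, xs b : ℚ) : ℚ_[p])‖ = 1) :
    MissingUpperBoundAt W p :=
  hX.missingUpperBoundAt_of_muAnZeroAt_of_not_surj hJs hJn hGZK hpar h12 hns hsp h15 h18 hfine hGS hnsj
    (muAnZeroAt_of_cosetTable hMz hX.ne_two hX.mult hX.irr t ht htint n s₀ S hS xs hxs hunit)

/-- **PER-PAIR DOOR, NON-SPLIT variant — no Greenberg–Stevens binder** (`greenberg_stevens` is vacuous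
at a non-split prime; ty2 §1c `ClassX11a.missingUpperBoundAt_of_muAnZeroAt_of_not_surj_of_nonsplit`).
[cite: Kato2004Asterisque, Thm. 12.4 (p. 221), §17.13 (pp. 279–280)] [cite: Wuthrich2014, Cor. 18 (p. 398)]
[cite: MazurTateTeitelbaum1986Invent, §I.10, §I.12–I.13] [cite: Mazur1978, Cor. 4.1] -/
theorem _root_.Summit.BirchSwinnertonDyer.Rank1Residual.ClassX11a.missingUpperBoundAt_of_cosetTable_of_nonsplit
    (hJs : thm61_splitMultiplicative) (hJn : thm61_nonsplitMultiplicative)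
    (hGZK : rank_eq_analyticRank_of_analyticRank_le_one) (hpar : nonempty_modularParametrizationData)
    (h12 : Kato2004.thm12_4)
    (hns : Kato2004.exists_multDivisibilityInputs_nonsplit)
    (hsp : Kato2004.exists_multDivisibilityInputs_split)
    (h15 : thm15_isTorsion_multiplicative_rat)
    (h18 : Wuthrich2014.corollary18_padicLFunction_mem_iwasawaAlgebra_multiplicative)
    (hfine : Kato2004.exists_multDivisibilityInputs_fine)
    (hMz : mazur_not_dvd_maninConstant_of_odd)
    (hX : ClassX11a W p) (hnsj : ¬ Surj W p) (hnsp : ¬ W.HasSplitMultiplicativeReductionAtPrime p)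
    (t : ℚ) (ht : W.entireLFunction 1 / (W.realPeriodRat : ℂ) = (t : ℂ))
    (htint : ‖((t : ℚ) : ℚ_[p])‖ ≤ 1) (n : ℕ) (s₀ : ZMod (p ^ n)) (S : Finset (ZMod (p ^ (n + 1))))
    (hS : ∀ b : ZMod (p ^ (n + 1)),
      b ∈ S ↔ b ^ (p - 1) = ((1 + p : ℕ) : ZMod (p ^ (n + 1))) ^ ((p - 1) * s₀.val))
    (xs : ZMod (p ^ (n + 1)) → ℚ)
    (hxs : ∀ {N : ℕ} [NeZero N] (f : CuspForm (Gamma0 N) 2), IsNewformOf W f →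
      ∀ (ϖ : ℚ), (ϖ : ℝ) * W.realPeriodRat = plusPeriod f →
        ∀ b ∈ S, ϖ * ratPlusSymbol f ((b.val : ℚ) / (p : ℚ) ^ (n + 1)) = xs b)
    (hunit : ‖((∑ b ∈ S, xs b : ℚ) : ℚ_[p])‖ = 1) :
    MissingUpperBoundAt W p :=
  hX.missingUpperBoundAt_of_muAnZeroAt_of_not_surj_of_nonsplit hJs hJn hGZK hpar h12 hns hsp h15 h18 hfine
    hnsj hnsp (muAnZeroAt_of_cosetTable hMz hX.ne_two hX.mult hX.irr t ht htint n s₀ S hS xs hxs hunit)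

/-- **PER-PAIR DOOR (`BSD(E,p)`) at a non-surjective UNIT X11a pair** (`#Ш_an = q`, `ord_p q = 0`, so
the lower half is free): the coset table for the upper half through ty2's
`ClassX11a.bsdp_of_muAnZeroAt_of_not_surj_of_unit`. PER PAIR (E1 currency); modulo the ten facts +
GS + Mazur + the image bit + the displayed table and special value. [cite: Miller2011LMS, §1 and Def. 1.1]
[cite: Kato2004Asterisque, §17.13 (pp. 279–280)] [cite: MazurTateTeitelbaum1986Invent, §I.10, §I.12–I.13]
[cite: Mazur1978, Cor. 4.1] -/
theorem _root_.Summit.BirchSwinnertonDyer.Rank1Residual.ClassX11a.bsdp_of_cosetTable_of_unit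
    (hJs : thm61_splitMultiplicative) (hJn : thm61_nonsplitMultiplicative)
    (hGZK : rank_eq_analyticRank_of_analyticRank_le_one) (hpar : nonempty_modularParametrizationData)
    (h12 : Kato2004.thm12_4)
    (hns : Kato2004.exists_multDivisibilityInputs_nonsplit)
    (hsp : Kato2004.exists_multDivisibilityInputs_split)
    (h15 : thm15_isTorsion_multiplicative_rat)
    (h18 : Wuthrich2014.corollary18_padicLFunction_mem_iwasawaAlgebra_multiplicative)
    (hfine : Kato2004.exists_multDivisibilityInputs_fine)
    (hGS : greenberg_stevens (W := W) (p := p)) (hMz : mazur_not_dvd_maninConstant_of_odd)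
    (hX : ClassX11a W p) (hnsj : ¬ Surj W p)
    (t : ℚ) (ht : W.entireLFunction 1 / (W.realPeriodRat : ℂ) = (t : ℂ))
    (htint : ‖((t : ℚ) : ℚ_[p])‖ ≤ 1) (n : ℕ) (s₀ : ZMod (p ^ n)) (S : Finset (ZMod (p ^ (n + 1))))
    (hS : ∀ b : ZMod (p ^ (n + 1)),
      b ∈ S ↔ b ^ (p - 1) = ((1 + p : ℕ) : ZMod (p ^ (n + 1))) ^ ((p - 1) * s₀.val))
    (xs : ZMod (p ^ (n + 1)) → ℚ)
    (hxs : ∀ {N : ℕ} [NeZero N] (f : CuspForm (Gamma0 N) 2), IsNewformOf W f →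
      ∀ (ϖ : ℚ), (ϖ : ℝ) * W.realPeriodRat = plusPeriod f →
        ∀ b ∈ S, ϖ * ratPlusSymbol f ((b.val : ℚ) / (p : ℚ) ^ (n + 1)) = xs b)
    (hunit : ‖((∑ b ∈ S, xs b : ℚ) : ℚ_[p])‖ = 1)
    {q : ℚ} (hq : shaAn W = (q : ℂ)) (hv : padicValRat p q = 0) : BSDp W p :=
  hX.bsdp_of_muAnZeroAt_of_not_surj_of_unit hJs hJn hGZK hpar h12 hns hsp h15 h18 hfine hGS hnsj
    (muAnZeroAt_of_cosetTable hMz hX.ne_two hX.mult hX.irr t ht htint n s₀ S hS xs hxs hunit) hq hv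

/-- **PER-PAIR DOOR (`BSD(E,p)`), NON-SPLIT UNIT variant — no Greenberg–Stevens binder.**
[cite: Miller2011LMS, §1 and Def. 1.1] [cite: Kato2004Asterisque, §17.13 (pp. 279–280)]
[cite: MazurTateTeitelbaum1986Invent, §I.10, §I.12–I.13] [cite: Mazur1978, Cor. 4.1] -/
theorem _root_.Summit.BirchSwinnertonDyer.Rank1Residual.ClassX11a.bsdp_of_cosetTable_of_nonsplit_of_unit
    (hJs : thm61_splitMultiplicative) (hJn : thm61_nonsplitMultiplicative)
    (hGZK : rank_eq_analyticRank_of_analyticRank_le_one) (hpar : nonempty_modularParametrizationData)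
    (h12 : Kato2004.thm12_4)
    (hns : Kato2004.exists_multDivisibilityInputs_nonsplit)
    (hsp : Kato2004.exists_multDivisibilityInputs_split)
    (h15 : thm15_isTorsion_multiplicative_rat)
    (h18 : Wuthrich2014.corollary18_padicLFunction_mem_iwasawaAlgebra_multiplicative)
    (hfine : Kato2004.exists_multDivisibilityInputs_fine)
    (hMz : mazur_not_dvd_maninConstant_of_odd)
    (hX : ClassX11a W p) (hnsj : ¬ Surj W p) (hnsp : ¬ W.HasSplitMultiplicativeReductionAtPrime p)
    (t : ℚ) (ht : W.entireLFunction 1 / (W.realPeriodRat : ℂ) = (t : ℂ))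
    (htint : ‖((t : ℚ) : ℚ_[p])‖ ≤ 1) (n : ℕ) (s₀ : ZMod (p ^ n)) (S : Finset (ZMod (p ^ (n + 1))))
    (hS : ∀ b : ZMod (p ^ (n + 1)),
      b ∈ S ↔ b ^ (p - 1) = ((1 + p : ℕ) : ZMod (p ^ (n + 1))) ^ ((p - 1) * s₀.val))
    (xs : ZMod (p ^ (n + 1)) → ℚ)
    (hxs : ∀ {N : ℕ} [NeZero N] (f : CuspForm (Gamma0 N) 2), IsNewformOf W f →
      ∀ (ϖ : ℚ), (ϖ : ℝ) * W.realPeriodRat = plusPeriod f →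
        ∀ b ∈ S, ϖ * ratPlusSymbol f ((b.val : ℚ) / (p : ℚ) ^ (n + 1)) = xs b)
    (hunit : ‖((∑ b ∈ S, xs b : ℚ) : ℚ_[p])‖ = 1)
    {q : ℚ} (hq : shaAn W = (q : ℂ)) (hv : padicValRat p q = 0) : BSDp W p :=
  hX.bsdp_of_muAnZeroAt_of_not_surj_of_nonsplit_of_unit hJs hJn hGZK hpar h12 hns hsp h15 h18 hfine
    hnsj hnsp (muAnZeroAt_of_cosetTable hMz hX.ne_two hX.mult hX.irr t ht htint n s₀ S hS xs hxs hunit) hq hv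

end Currency

/-! ### §7 Class-free rank-0 doors (the grammar of the per-pair record files: kernel `Mult`/`Irr`, displayed `r_an = 0`, image bit; any `μ`-certificate source) -/

section ClassFree

variable (W : WeierstrassCurve ℚ) [W.IsElliptic] [W.IsGloballyMinimal] (p : ℕ) [Fact p.Prime]

/-- **PER-PAIR DOOR, class-free** (the grammar of the record files `X11a/MuCosetRecords*.lean`): at an odd
multiplicative prime `p` with `E[p]` irreducible, `ρ̄_{E,p}` NOT onto (image bit, displayed) and
`ord_{s=1} L(E,s) = 0` (displayed), a `μ`-certificate `X11a.MuAnZeroAt W p` (e.g. from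
`muAnZeroAt_of_cosetTable`) gives `Typed.MissingUpperBoundAt W p` through the K2 cell's μ-transfer
WITHOUT big image (`X11b.multDivisibilityAt_of_katoFacts_of_muAnZeroAt`, uses `Irr ∧ ¬Surj`) and the
rank-`0` engine (`X11b.missingUpperBoundAt_of_multDivisibilityAt_of_analyticRank_eq_zero`), modulo the TEN
facts + Greenberg–Stevens; Kato (12.2.1) and the entire continuation are tree theorems
(`Kato2004.nonempty_iwasawaH1Data_holds`, `X2.ClassClosureEntireFree.…`). No `¬Ram` needed (ty2's
`ClassX11a` door minus the class). [cite: Kato2004Asterisque, Thm. 12.4 (p. 221), §17.13 (pp. 279–280)]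
[cite: Wuthrich2014, Cor. 18 (p. 398)] [cite: SteinWuthrich2013, Thm. 6.1 (p. 20)] [cite: Miller2011LMS, Def. 1.1] -/
theorem missingUpperBoundAt_of_muAnZeroAt_of_analyticRank_eq_zero
    (hJs : thm61_splitMultiplicative) (hJn : thm61_nonsplitMultiplicative)
    (hGZK : rank_eq_analyticRank_of_analyticRank_le_one) (hpar : nonempty_modularParametrizationData)
    (h12 : Kato2004.thm12_4)
    (hns : Kato2004.exists_multDivisibilityInputs_nonsplit)
    (hsp : Kato2004.exists_multDivisibilityInputs_split)
    (h15 : thm15_isTorsion_multiplicative_rat)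
    (h18 : Wuthrich2014.corollary18_padicLFunction_mem_iwasawaAlgebra_multiplicative)
    (hfine : Kato2004.exists_multDivisibilityInputs_fine)
    (hGS : greenberg_stevens (W := W) (p := p))
    (hp2 : p ≠ 2) (hr : W.analyticRank = 0) (hmult : W.HasMultiplicativeReductionAtPrime p)
    (hirr : W.HasIrreducibleModPGaloisRep p) (hnsj : ¬ Surj W p) (hμ : X11a.MuAnZeroAt W p) :
    MissingUpperBoundAt W p :=
  X11b.missingUpperBoundAt_of_multDivisibilityAt_of_analyticRank_eq_zero hJs hJn hGZK
    (X2.ClassClosureEntireFree.hasEntireLFunction_rat_of_nonempty_modularParametrizationData hpar) hpar W p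
    hGS hp2 hmult hr
    (X11b.multDivisibilityAt_of_katoFacts_of_muAnZeroAt Kato2004.nonempty_iwasawaH1Data_holds h12 hns hsp
      h15 h18 hfine W p hp2 hmult hirr hnsj hμ)

/-- **PER-PAIR DOOR, class-free, NON-SPLIT** (Greenberg–Stevens vacuous:
`RankZeroHeightFree.greenberg_stevens_of_not_split`). [cite: Kato2004Asterisque, §17.13 (pp. 279–280)]
[cite: Wuthrich2014, Cor. 18 (p. 398)] [cite: SteinWuthrich2013, Thm. 6.1 (p. 20)] -/
theorem missingUpperBoundAt_of_muAnZeroAt_of_analyticRank_eq_zero_of_nonsplit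
    (hJs : thm61_splitMultiplicative) (hJn : thm61_nonsplitMultiplicative)
    (hGZK : rank_eq_analyticRank_of_analyticRank_le_one) (hpar : nonempty_modularParametrizationData)
    (h12 : Kato2004.thm12_4)
    (hns : Kato2004.exists_multDivisibilityInputs_nonsplit)
    (hsp : Kato2004.exists_multDivisibilityInputs_split)
    (h15 : thm15_isTorsion_multiplicative_rat)
    (h18 : Wuthrich2014.corollary18_padicLFunction_mem_iwasawaAlgebra_multiplicative)
    (hfine : Kato2004.exists_multDivisibilityInputs_fine)
    (hp2 : p ≠ 2) (hr : W.analyticRank = 0) (hmult : W.HasMultiplicativeReductionAtPrime p)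
    (hirr : W.HasIrreducibleModPGaloisRep p) (hnsj : ¬ Surj W p)
    (hnsp : ¬ W.HasSplitMultiplicativeReductionAtPrime p) (hμ : X11a.MuAnZeroAt W p) :
    MissingUpperBoundAt W p :=
  missingUpperBoundAt_of_muAnZeroAt_of_analyticRank_eq_zero W p hJs hJn hGZK hpar h12 hns hsp h15 h18 hfine
    (RankZeroHeightFree.greenberg_stevens_of_not_split W p hnsp) hp2 hr hmult hirr hnsj hμ

omit [W.IsGloballyMinimal] [Fact p.Prime] in
/-- **`BSD(E,p)` from the two halves in analytic rank `0`, class-free**: the upper half and a displayed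
`#Ш_an = q` with `ord_p q = 0` (lower half free) give `BSDp W p` via GZK
(`Typed.bsdp_of_missingPPartAt`). Bookkeeping. [cite: Miller2011LMS, §1 and Def. 1.1] -/
theorem bsdp_of_upper_of_unit_of_analyticRank_eq_zero [Fact p.Prime]
    (hGZK : rank_eq_analyticRank_of_analyticRank_le_one) (hr : W.analyticRank = 0)
    (hup : MissingUpperBoundAt W p) {q : ℚ} (hq : shaAn W = (q : ℂ)) (hv : padicValRat p q = 0) :
    BSDp W p :=
  bsdp_of_missingPPartAt W p hGZK (hr.trans_le zero_le_one)
    (missingPPartAt_of_lower_of_upper W p ⟨q, hq, by rw [hv]; exact Nat.cast_nonneg _⟩ hup)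

end ClassFree

/-! ### §8 Kernel helper for the record files: a displayed reduced fraction `a/d` with `p ∤ a`, `p ∤ d` is a `p`-adic unit -/

/-- `‖a/d‖_p = 1` for `p ∤ a` and `p ∤ d` (`a ∈ ℤ`, `d ∈ ℕ`): both `‖a‖_p` and `‖d‖_p` equal `1`
(Mathlib `Padic.norm_int_le_one`, `Padic.norm_intCast_lt_one_iff`). The record files read the unit coset
sum through this (the two divisibilities are `decide`d). [folklore] -/
theorem MuCoset.norm_intCast_div_natCast_eq_one {p : ℕ} [Fact p.Prime] {a : ℤ} {d : ℕ}
    (ha : ¬ (p : ℤ) ∣ a) (hd : ¬ p ∣ d) : ‖((((a : ℚ) / (d : ℚ)) : ℚ) : ℚ_[p])‖ = 1 := by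
  have hint : ∀ z : ℤ, ¬ (p : ℤ) ∣ z → ‖(z : ℚ_[p])‖ = 1 := fun z hz ↦
    le_antisymm (Padic.norm_int_le_one z)
      (not_lt.mp fun h ↦ hz (Padic.norm_intCast_lt_one_iff.mp h))
  have hd' : ¬ (p : ℤ) ∣ (d : ℤ) := fun h ↦ hd (Int.natCast_dvd_natCast.mp h)
  rw [Rat.cast_div, Rat.cast_intCast, Rat.cast_natCast, norm_div, hint a ha, ← Int.cast_natCast,
    hint (d : ℤ) hd', div_one]

end Summit.BirchSwinnertonDyer.Rank1Residual.X11a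

end
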